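import Literature.Analysis.FluidPDE.NSVorticityHelicityProofs
import Literature.Analysis.FluidPDE.LocalBiotSavartCalculus
import HarnessLib

/-!
# Superhelicity and the viscous helicity balance

Topic `Literature/Analysis/FluidPDE` (definition request `defn-superhelicity`, wanted by route
AdiabaticEddy of `Summits/NavierStokesRegularity`, items `stmt-NavierStokesRegularity-1432`
ChiralEddyExists / `stmt-…-1429` CorrectorSolvable, and the idea cards
heterochiral-transfer-budget / adiabatic-eddy-chirality-law, which so far inline
`∫ x, inner ℝ (curl U x) (curl (curl U) x)`).

## Main definitions

* `Literature.Analysis.FluidPDE.superhelicity u = ∫ ⟪curl u, curl (curl u)⟫`: the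
  **superhelicity** of a velocity field `u : ℝ³ → ℝ³`, i.e. the helicity of its vorticity field
  `ω = curl u` (`superhelicity_eq_helicity_curl`: `superhelicity u = helicity (curl u)`, `rfl`).
  The name is Hide's (1989); Frisch writes `H_ω = ⟨½ ω · ∇∧ω⟩` ("mean vortical helicity",
  (2.28), with his factor `½` and a box average in place of the integral); Moffatt–Tsinober (1992)
  review it as the helicity-dissipation integral. Bochner integral, junk value `0` when
  `⟪ω, curl ω⟫` is not integrable — the same convention as the sibling
  `Literature.Analysis.FluidPDE.helicity`.

## Main statements (all proved; no named facts are introduced)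

* `superhelicity_eq_helicity_curl`, `superhelicity_eq_helicity_vorticity`,
  `superhelicity_eq_integral_inner` (unfolding, `rfl`),
  `superhelicity_zero`, `superhelicity_neg` (parity-even: `S(−u) = S(u)`, whereas a mirror
  reflection flips the sign), `superhelicity_const_smul` (`S(c • u) = c² S(u)`, no regularity
  hypothesis).
* `IsClassicalNSSolutionOn.integral_inner_timeDerivWithin_curl_eq`: for a classical unforced
  Navier–Stokes solution with viscosity `ν` on `ℝ³ × S` (`S` of unique differentiability) whose
  velocity decays rapidly in space uniformly in time, `∫ ⟪∂ₜu(t), curl u(t)⟫ = −ν S(u(t))`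
  for `t ∈ S`.
* `IsClassicalNSSolutionOn.hasDerivWithinAt_helicity` — **the viscous helicity balance**
  `dH/dt = −2ν S(u(t))`: on a convex time set `S`, `t ↦ helicity (u t)` has derivative
  `−(2ν · superhelicity (u t))` within `S` at every `t ∈ S` (Frisch 1995, (2.24)/(2.29):
  `d/dt ⟨½ v·ω⟩ = −ν ⟨ω · ∇∧ω⟩`; Moffatt–Tsinober 1992; for `ν = 0` this is the conservation of
  helicity, Majda–Bertozzi Prop. 1.12 (iv), already in the tree as
  `euler_helicity_conservation_holds`, and for `ν > 0` it is the "exercise for the interested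
  reader" of Majda–Bertozzi §1.7, p. 27, after Prop. 1.13).
* `IsClassicalEulerSolutionOn.hasDerivWithinAt_helicity`: the Euler case, derivative `0`.

## Proof of the balance law

Frisch's proof ((2.26)–(2.27): `d/dt ⟨v·ω⟩ = 2⟨v·∂ₜω⟩` by the self-adjointness (2.20) of the
curl, then the vorticity equation and `⟨u·∇²v⟩ = −⟨(∇∧u)·(∇∧v)⟩` for `∇·v = 0`, (2.21)),
transposed from the periodic box to `ℝ³` with decay exactly as the tree's proof of the Euler case
(`NSVorticityHelicityProofs`): differentiate `∫ ⟪u, curl u⟫` under the integral sign within `S`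
(`hasDerivWithinAt_integral_of_dominated_convex`, dominated through the uniform decay of `u`,
`Du`, `∂ₜu`, `D∂ₜu`), use `∂ₜ curl u = curl ∂ₜu` and `∫ ⟪u, curl ∂ₜu⟫ = ∫ ⟪curl u, ∂ₜu⟫`
(`integral_inner_curl_eq_integral_inner_curl_of_decay`), so `dH/dt = 2 ∫ ⟪∂ₜu, ω⟫`; at fixed
time `∂ₜu = νΔu − (u·∇)u − ∇p = −ν curl ω − ω × u − ∇(p + ½|u|²)` (momentum equation,
`Δu = −curl curl u` for `div u = 0` — the tree's `laplacian_eq_neg_curl_curl` — and the Lamb form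
`convect_self_eq_cross_curl_add_gradient`), where `⟪ω × u, ω⟫ = 0` and both gradient pairings
vanish by Majda–Bertozzi's Lemma 1.5 (`integral_inner_gradient_eq_zero`; `div ω = 0`, the
gradients are bounded), leaving `∫ ⟪∂ₜu, ω⟫ = −ν ∫ ⟪ω, curl ω⟫`.

## Mathlib / tree search

Mathlib (this pin) has no helicity or superhelicity (searched `helicity`, `superhelicity`: none);
the tree has `helicity`, `curl`, the Euler conservation law and all the whole-space calculus used
here (`lean search superhelicity`: only prose mentions in `Summits/…/Theses`).

## References

* U. Frisch, *Turbulence: The Legacy of A. N. Kolmogorov*, CUP 1995, §2.3, eqs. (2.20)–(2.21),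
  (2.24), (2.26)–(2.29) (read: held copy, PDF pp. 16–17). [FrischTurbulence1995]
* R. Hide, *Superhelicity, helicity and potential vorticity*, Geophys. Astrophys. Fluid Dyn. 48
  (1989) 69–79, doi:10.1080/03091928908219526 (the name; paywalled, acq-02235). [Hide1989]
* H. K. Moffatt, A. Tsinober, *Helicity in laminar and turbulent flow*, Annu. Rev. Fluid Mech. 24
  (1992) 281–312, doi:10.1146/annurev.fl.24.010192.001433. [MoffattTsinober1992]
* A. J. Majda, A. L. Bertozzi, *Vorticity and Incompressible Flow*, CUP 2002, §1.7, Prop. 1.12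
  (iv) (1.67), Lemma 1.5, Prop. 1.13 and p. 27 (viscous counterparts "left as an exercise")
  (read: held copy, PDF pp. 27–31). [MajdaBertozziCUP2002]
-/

noncomputable section

open MeasureTheory Set Function Filter Topology InnerProductSpace
open scoped ContDiff InnerProductSpace RealInnerProductSpace Laplacian

namespace Literature.Analysis.FluidPDE

/-! ### The definition and its elementary API -/

/-- The **superhelicity** `S(u) = ∫ ⟪ω(x), curl ω(x)⟫ dx`, `ω = curl u`, of a velocity field
`u : ℝ³ → ℝ³`: the helicity of the vorticity field (Hide 1989), Frisch's "vortical helicity"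
`H_ω = ⟨½ ω · ∇∧ω⟩` up to his factor `½` and box normalisation; it is the helicity-dissipation
integral of viscous flow, `dH/dt = −2ν S` (`IsClassicalNSSolutionOn.hasDerivWithinAt_helicity`).
Bochner integral against Lebesgue measure on `ℝ³`; junk value `0` if `⟪ω, curl ω⟫` is not
integrable (same convention as `helicity`).
[cite: FrischTurbulence1995, §2.3 eq. (2.28)–(2.29)] [cite: Hide1989, title and §1] -/
def superhelicity (u : EuclideanSpace ℝ (Fin 3) → EuclideanSpace ℝ (Fin 3)) : ℝ :=
  ∫ x, ⟪curl u x, curl (curl u) x⟫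

/-- Unfolding: `superhelicity u = ∫ ⟪curl u x, curl (curl u) x⟫ dx` — the expression inlined by
route AdiabaticEddy (`∫ x, inner ℝ (curl U x) (curl (curl U) x)`). [folklore] -/
theorem superhelicity_eq_integral_inner (u : EuclideanSpace ℝ (Fin 3) → EuclideanSpace ℝ (Fin 3)) :
    superhelicity u = ∫ x, ⟪curl u x, curl (curl u) x⟫ :=
  rfl

/-- Superhelicity is the helicity of the vorticity field: `S(u) = H(curl u)` (Hide 1989;
definitional). [cite: Hide1989, title and §1] -/
theorem superhelicity_eq_helicity_curl (u : EuclideanSpace ℝ (Fin 3) → EuclideanSpace ℝ (Fin 3)) :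
    superhelicity u = helicity (curl u) :=
  rfl

/-- Along a time-dependent velocity field, the superhelicity of the slice `u t` is the helicity
of the vorticity slice `vorticity u t = curl (u t)` (definitional). [folklore] -/
theorem superhelicity_eq_helicity_vorticity
    (u : ℝ → EuclideanSpace ℝ (Fin 3) → EuclideanSpace ℝ (Fin 3)) (t : ℝ) :
    superhelicity (u t) = helicity (vorticity u t) :=
  rfl

/-- `curl (c • u) = c • curl u` for every real `c`, with no differentiability hypothesis (both
sides carry the same junk value, Mathlib `fderiv_const_smul_field`); function-level form of the
tree's pointwise `curl_const_smul_field` (`EulerTimeScaling.lean`, not imported here to keep this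
file's import closure small). [folklore] -/
private theorem curl_pi_const_smul (c : ℝ)
    (u : EuclideanSpace ℝ (Fin 3) → EuclideanSpace ℝ (Fin 3)) : curl (c • u) = c • curl u := by
  funext x
  rw [Pi.smul_apply, curl_eq_curlCLM, curl_eq_curlCLM, fderiv_const_smul_field c, Pi.smul_apply,
    map_smul]

/-- `curl (-u) = -curl u` (everywhere, junk values included; function-level form of the tree's
pointwise `curl_neg`). [folklore] -/
private theorem curl_pi_neg (u : EuclideanSpace ℝ (Fin 3) → EuclideanSpace ℝ (Fin 3)) :
    curl (-u) = -curl u := by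
  funext x
  exact curl_neg u x

/-- The superhelicity of the zero field vanishes. [folklore] -/
@[simp]
theorem superhelicity_zero :
    superhelicity (0 : EuclideanSpace ℝ (Fin 3) → EuclideanSpace ℝ (Fin 3)) = 0 := by
  have h0 : curl (0 : EuclideanSpace ℝ (Fin 3) → EuclideanSpace ℝ (Fin 3)) = 0 :=
    funext fun x => curl_zero x
  simp [superhelicity, h0]

/-- Superhelicity is even under `u ↦ −u`: `S(−u) = S(u)` (both curls change sign). [folklore] -/
@[simp]
theorem superhelicity_neg (u : EuclideanSpace ℝ (Fin 3) → EuclideanSpace ℝ (Fin 3)) :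
    superhelicity (-u) = superhelicity u := by
  simp only [superhelicity, curl_pi_neg, Pi.neg_apply, inner_neg_neg]

/-- Quadratic scaling in the amplitude: `S(c • u) = c² S(u)`. [folklore] -/
theorem superhelicity_const_smul (c : ℝ) (u : EuclideanSpace ℝ (Fin 3) → EuclideanSpace ℝ (Fin 3)) :
    superhelicity (c • u) = c ^ 2 * superhelicity u := by
  simp only [superhelicity, curl_pi_const_smul, Pi.smul_apply, real_inner_smul_left,
    real_inner_smul_right, ← mul_assoc, integral_const_mul, sq]

/-! ### The viscous helicity balance -/

/-- `⟪a × b, a⟫ = 0`. [folklore] -/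
private theorem inner_cross_self_left_aux (a b : EuclideanSpace ℝ (Fin 3)) : ⟪cross a b, a⟫ = 0 := by
  simp [cross, cross_apply, PiLp.inner_apply, Fin.sum_univ_three]
  ring

section Balance

variable {S : Set ℝ} {ν : ℝ} {u : ℝ → EuclideanSpace ℝ (Fin 3) → EuclideanSpace ℝ (Fin 3)}
  {p : ℝ → EuclideanSpace ℝ (Fin 3) → ℝ}
set_option maxHeartbeats 400000 in -- buildfix (bf3-g27): 160k/180k FAIL, 200k PASS at accept time; line-neutral budget line
/-- **`∫ ⟪∂ₜu, curl u⟫ = −ν S(u)` for a decaying classical Navier–Stokes solution** (the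
fixed-time content of the helicity balance, Frisch 1995 (2.27) with (2.20)–(2.21); Majda–Bertozzi
§1.7, proof of Prop. 1.12 (iv) plus the viscous term): on a time set `S` of unique
differentiability, for a classical unforced Navier–Stokes solution with viscosity `ν` and
uniformly rapidly decaying velocity, and `t ∈ S`,
`∫ ⟪∂ₜu(t), ω(t)⟫ = −ν ∫ ⟪ω(t), curl ω(t)⟫`, `ω = curl u`. Proof:
`∂ₜu = νΔu − (u·∇)u − ∇p = −ν curl ω − ω × u − ∇(p + ½|u|²)` (`Δu = −curl curl u` for
`div u = 0`, Lamb form), `⟪ω × u, ω⟫ = 0`, and both gradient pairings vanish by Lemma 1.5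
(`integral_inner_gradient_eq_zero`: `div ω = 0` and the gradients are bounded).
[cite: FrischTurbulence1995, §2.3 eqs. (2.21), (2.24), (2.27)] -/
theorem IsClassicalNSSolutionOn.integral_inner_timeDerivWithin_curl_eq
    (h : IsClassicalNSSolutionOn S ν 0 u p) (hU : UniqueDiffOn ℝ S)
    (hu : HasUniformRapidDecayOn S u) {t : ℝ} (ht : t ∈ S) :
    ∫ x, ⟪FluidPDE.timeDerivWithin S u t x, curl (u t) x⟫ = -(ν * superhelicity (u t)) := by
  have hsm := h.smooth_velocity
  -- decay exponent `5 > dim + 1 = 4` and constants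
  have hr : (Module.finrank ℝ (EuclideanSpace ℝ (Fin 3)) : ℝ) + 1 < ((5 : ℕ) : ℝ) := by
    rw [finrank_euclideanSpace_fin]; norm_num
  have hr3 : (Module.finrank ℝ (EuclideanSpace ℝ (Fin 3)) : ℝ) < ((5 : ℕ) : ℝ) := by linarith
  have hK0 : (0 : ℝ) ≤ ((5 : ℕ) : ℝ) := by norm_num
  obtain ⟨A0, hA0, hA0b⟩ := hu.norm_le_rpow 5
  obtain ⟨A1, hA1, hA1b⟩ := hu.norm_fderiv_le_rpow hsm hU 5
  obtain ⟨A2, hA2, hA2b⟩ := hu.norm_fderiv_fderiv_le_rpow hsm hU 5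
  obtain ⟨A3, hA3, hA3b⟩ := hu.norm_timeDerivWithin_le_rpow hsm hU 5
  set C : ℝ := A0 + A1 + A2 + A3 with hC_def
  have hC : 0 ≤ C := by rw [hC_def]; positivity
  have h0 : ∀ x, ‖u t x‖ ≤ C * (1 + ‖x‖) ^ (-((5 : ℕ) : ℝ)) := fun x =>
    le_decay_of_le_decay x (hA0b t ht x) (by rw [hC_def]; linarith)
  have h1 : ∀ x, ‖fderiv ℝ (u t) x‖ ≤ C * (1 + ‖x‖) ^ (-((5 : ℕ) : ℝ)) := fun x =>
    le_decay_of_le_decay x (hA1b t ht x) (by rw [hC_def]; linarith)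
  have h2 : ∀ x, ‖fderiv ℝ (fderiv ℝ (u t)) x‖ ≤ C * (1 + ‖x‖) ^ (-((5 : ℕ) : ℝ)) := fun x =>
    le_decay_of_le_decay x (hA2b t ht x) (by rw [hC_def]; linarith)
  have h3 : ∀ x, ‖FluidPDE.timeDerivWithin S u t x‖ ≤ C * (1 + ‖x‖) ^ (-((5 : ℕ) : ℝ)) :=
    fun x => le_decay_of_le_decay x (hA3b t ht x) (by rw [hC_def]; linarith)
  have hw1 (x : EuclideanSpace ℝ (Fin 3)) : (1 + ‖x‖) ^ (-((5 : ℕ) : ℝ)) ≤ (1 : ℝ) :=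
    rpow_neg_le_one x hK0
  -- regularity of the slices
  have hv2 : ContDiff ℝ 2 (u t) := contDiff_infty.1 (h.contDiff_velocity ht) 2
  have hv1 : ContDiff ℝ 1 (u t) := contDiff_infty.1 (h.contDiff_velocity ht) 1
  have hq : ContDiff ℝ ∞ (p t) := h.contDiff_pressure ht
  have hq1 : ContDiff ℝ 1 (p t) := contDiff_infty.1 hq 1
  have hω1 : ContDiff ℝ 1 (curl (u t)) := contDiff_curl (n := 1) (by exact_mod_cast hv2)
  have hωc : Continuous (curl (u t)) := continuous_curl hv1
  have hcωc : Continuous (curl (curl (u t))) := continuous_curl hω1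
  -- decay of the vorticity, of its derivative and of its curl
  have hω0 : ∀ x, ‖curl (u t) x‖ ≤ ‖curlCLM‖ * C * (1 + ‖x‖) ^ (-((5 : ℕ) : ℝ)) := fun x => by
    calc ‖curl (u t) x‖ ≤ ‖curlCLM‖ * ‖fderiv ℝ (u t) x‖ := norm_curl_le _ x
      _ ≤ ‖curlCLM‖ * (C * (1 + ‖x‖) ^ (-((5 : ℕ) : ℝ))) := by gcongr; exact h1 x
      _ = ‖curlCLM‖ * C * (1 + ‖x‖) ^ (-((5 : ℕ) : ℝ)) := by ring
  have hωD : ∀ x, ‖fderiv ℝ (curl (u t)) x‖ ≤ ‖curlCLM‖ * C * (1 + ‖x‖) ^ (-((5 : ℕ) : ℝ)) :=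
    fun x => by
    rw [fderiv_curl hv2 x]
    calc ‖curlCLM.comp (fderiv ℝ (fderiv ℝ (u t)) x)‖
        ≤ ‖curlCLM‖ * ‖fderiv ℝ (fderiv ℝ (u t)) x‖ := ContinuousLinearMap.opNorm_comp_le _ _
      _ ≤ ‖curlCLM‖ * (C * (1 + ‖x‖) ^ (-((5 : ℕ) : ℝ))) := by gcongr; exact h2 x
      _ = ‖curlCLM‖ * C * (1 + ‖x‖) ^ (-((5 : ℕ) : ℝ)) := by ring
  have hcω0 : ∀ x, ‖curl (curl (u t)) x‖ ≤
      ‖curlCLM‖ * (‖curlCLM‖ * C) * (1 + ‖x‖) ^ (-((5 : ℕ) : ℝ)) := fun x => by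
    calc ‖curl (curl (u t)) x‖ ≤ ‖curlCLM‖ * ‖fderiv ℝ (curl (u t)) x‖ := norm_curl_le _ x
      _ ≤ ‖curlCLM‖ * (‖curlCLM‖ * C * (1 + ‖x‖) ^ (-((5 : ℕ) : ℝ))) := by gcongr; exact hωD x
      _ = ‖curlCLM‖ * (‖curlCLM‖ * C) * (1 + ‖x‖) ^ (-((5 : ℕ) : ℝ)) := by ring
  have hcω0' : ∀ x, ‖curl (curl (u t)) x‖ ≤ ‖curlCLM‖ * (‖curlCLM‖ * C) := fun x => by
    calc ‖curl (curl (u t)) x‖ ≤ ‖curlCLM‖ * (‖curlCLM‖ * C) * (1 + ‖x‖) ^ (-((5 : ℕ) : ℝ)) :=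
          hcω0 x
      _ ≤ ‖curlCLM‖ * (‖curlCLM‖ * C) * 1 := by gcongr; exact hw1 x
      _ = ‖curlCLM‖ * (‖curlCLM‖ * C) := mul_one _
  have hωdiv : VectorCalculus.IsDivFree (curl (u t)) := fun x =>
    divergence_curl_eq_zero_holds (u t) hv2 x
  -- `Δu = -curl curl u` (incompressibility)
  have hΔ : ∀ x, (Δ (u t)) x = -curl (curl (u t)) x := fun x =>
    laplacian_eq_neg_curl_curl hv2 (h.divFree t ht) x
  -- the Navier–Stokes equation at time `t`: `∂ₜu = νΔu − (u·∇)u − ∇p`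
  have hE : ∀ x, FluidPDE.timeDerivWithin S u t x =
      ν • (Δ (u t)) x - convect (u t) (u t) x - gradient (p t) x := by
    intro x
    have hm := h.momentum t ht x
    simp only [Pi.zero_apply, add_zero] at hm
    exact (eq_sub_of_add_eq hm).trans (sub_right_comm _ _ _)
  -- the Lamb form and the Bernoulli function `q = ½|u|²`
  set q : EuclideanSpace ℝ (Fin 3) → ℝ := fun y => ‖u t y‖ ^ 2 / 2 with hq_def
  have hqd : ∀ x, HasFDerivAt q ((innerSL ℝ (u t x)).comp (fderiv ℝ (u t) x)) x := fun x =>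
    hasFDerivAt_half_norm_sq (hv1.differentiable one_ne_zero x)
  have hq1' : ContDiff ℝ 1 q := by
    have : ContDiff ℝ 1 fun y => ‖u t y‖ ^ 2 := hv1.norm_sq ℝ
    simpa [hq_def, div_eq_mul_inv] using this.mul contDiff_const
  have hLamb : ∀ x, convect (u t) (u t) x = cross (curl (u t) x) (u t x) + gradient q x :=
    fun x => convect_self_eq_cross_curl_add_gradient (hv1.differentiable one_ne_zero x)
  -- bounded gradients: `∇q` and `∇p = νΔu − (u·∇)u − ∂ₜu`
  have hqg : ∀ x, ‖gradient q x‖ ≤ C * C := fun x => by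
    rw [gradient, LinearIsometryEquiv.norm_map, (hqd x).fderiv]
    calc ‖(innerSL ℝ (u t x)).comp (fderiv ℝ (u t) x)‖
        ≤ ‖innerSL ℝ (u t x)‖ * ‖fderiv ℝ (u t) x‖ := ContinuousLinearMap.opNorm_comp_le _ _
      _ ≤ C * (1 + ‖x‖) ^ (-((5 : ℕ) : ℝ)) * (C * (1 + ‖x‖) ^ (-((5 : ℕ) : ℝ))) := by
          rw [innerSL_apply_norm]
          exact mul_le_mul (h0 x) (h1 x) (norm_nonneg _) (by positivity)
      _ ≤ C * 1 * (C * 1) := by gcongr <;> exact hw1 x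
      _ = C * C := by ring
  have hconv : ∀ x, ‖convect (u t) (u t) x‖ ≤ C * C := fun x => by
    rw [convect_apply]
    calc ‖fderiv ℝ (u t) x (u t x)‖ ≤ ‖fderiv ℝ (u t) x‖ * ‖u t x‖ :=
          ContinuousLinearMap.le_opNorm _ _
      _ ≤ C * (1 + ‖x‖) ^ (-((5 : ℕ) : ℝ)) * (C * (1 + ‖x‖) ^ (-((5 : ℕ) : ℝ))) :=
          mul_le_mul (h1 x) (h0 x) (norm_nonneg _) (by positivity)
      _ ≤ C * 1 * (C * 1) := by gcongr <;> exact hw1 x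
      _ = C * C := by ring
  have hνΔ : ∀ x, ‖ν • (Δ (u t)) x‖ ≤ |ν| * (‖curlCLM‖ * (‖curlCLM‖ * C)) := fun x => by
    rw [norm_smul, Real.norm_eq_abs, hΔ x, norm_neg]
    exact mul_le_mul_of_nonneg_left (hcω0' x) (abs_nonneg ν)
  have h3' : ∀ x, ‖FluidPDE.timeDerivWithin S u t x‖ ≤ C := fun x =>
    (h3 x).trans (mul_le_of_le_one_right hC (hw1 x))
  have hpg : ∀ x, ‖gradient (p t) x‖ ≤ |ν| * (‖curlCLM‖ * (‖curlCLM‖ * C)) + C * C + C :=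
      fun x => by
    have hpx : gradient (p t) x =
        ν • (Δ (u t)) x - convect (u t) (u t) x - FluidPDE.timeDerivWithin S u t x :=
      eq_sub_of_add_eq' (eq_sub_iff_add_eq.1 (hE x))
    rw [hpx]
    exact norm_sub_le_of_le (norm_sub_le_of_le (hνΔ x) (hconv x)) (h3' x)
  -- Lemma 1.5: both gradient pairings vanish
  have hIq : ∫ x, ⟪gradient q x, curl (u t) x⟫ = 0 :=
    integral_inner_gradient_eq_zero hω1 hq1' hωdiv hr hω0 hωD hqg
  have hIp : ∫ x, ⟪gradient (p t) x, curl (u t) x⟫ = 0 :=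
    integral_inner_gradient_eq_zero hω1 hq1 hωdiv hr hω0 hωD hpg
  -- pointwise: `⟪∂ₜu, ω⟫ = −ν⟪ω, curl ω⟫ − ⟪∇q, ω⟫ − ⟪∇p, ω⟫`
  have hpt : ∀ x, ⟪FluidPDE.timeDerivWithin S u t x, curl (u t) x⟫ =
      -(ν * ⟪curl (u t) x, curl (curl (u t)) x⟫) - ⟪gradient q x, curl (u t) x⟫ -
        ⟪gradient (p t) x, curl (u t) x⟫ := fun x => by
    rw [hE x, hΔ x, hLamb x, inner_sub_left, inner_sub_left, real_inner_smul_left, inner_add_left,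
      inner_cross_self_left_aux, zero_add, inner_neg_left,
      real_inner_comm (curl (u t) x) (curl (curl (u t)) x), mul_neg]
  -- integrability of the three pairings
  have hIS_int : Integrable fun x => ⟪curl (u t) x, curl (curl (u t)) x⟫ := by
    refine integrable_of_norm_le_decay_mul_decay (C₁ := ‖curlCLM‖ * C)
      (C₂ := ‖curlCLM‖ * (‖curlCLM‖ * C)) (r := ((5 : ℕ) : ℝ)) (r' := ((5 : ℕ) : ℝ))
      (hωc.inner hcωc) hr3 hK0 (by positivity) (by positivity) fun x => ?_
    exact (norm_inner_le_norm _ _).trans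
      (mul_le_mul (hω0 x) (hcω0 x) (norm_nonneg _) (by positivity))
  have hIq_int : Integrable fun x => ⟪gradient q x, curl (u t) x⟫ := by
    refine integrable_of_norm_le_const_mul_decay (C₁ := C * C) (C₂ := ‖curlCLM‖ * C)
      (r := ((5 : ℕ) : ℝ)) ((continuous_gradient_of_contDiff hq1').inner hωc) hr3 fun x => ?_
    exact (norm_inner_le_norm _ _).trans
      (mul_le_mul (hqg x) (hω0 x) (norm_nonneg _) (by positivity))
  have hIp_int : Integrable fun x => ⟪gradient (p t) x, curl (u t) x⟫ := by
    refine integrable_of_norm_le_const_mul_decay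
      (C₁ := |ν| * (‖curlCLM‖ * (‖curlCLM‖ * C)) + C * C + C) (C₂ := ‖curlCLM‖ * C)
      (r := ((5 : ℕ) : ℝ)) ((continuous_gradient_of_contDiff hq1).inner hωc) hr3 fun x => ?_
    exact (norm_inner_le_norm _ _).trans
      (mul_le_mul (hpg x) (hω0 x) (norm_nonneg _) (by positivity))
  have hI1 : Integrable fun x => -(ν * ⟪curl (u t) x, curl (curl (u t)) x⟫) :=
    (hIS_int.const_mul ν).neg
  have hI12 : Integrable fun x =>
      -(ν * ⟪curl (u t) x, curl (curl (u t)) x⟫) - ⟪gradient q x, curl (u t) x⟫ :=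
    hI1.sub hIq_int
  simp_rw [hpt]
  rw [integral_sub hI12 hIp_int, integral_sub hI1 hIq_int, integral_neg, integral_const_mul, hIq,
    hIp, sub_zero, sub_zero, superhelicity]

/-- **The viscous helicity balance `dH/dt = −2ν S(u)`** (Frisch 1995, §2.3, (2.24)/(2.29):
`d/dt ⟨½ v·ω⟩ = −ν⟨ω · ∇∧ω⟩`, i.e. `dH/dt = −2ν H_ω` with `H = ⟨½ v·ω⟩`, `H_ω = ⟨½ ω·∇∧ω⟩`;
Moffatt–Tsinober 1992; the `ν > 0` counterpart of Majda–Bertozzi Prop. 1.12 (iv), left there as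
an exercise, §1.7 p. 27): for a classical unforced Navier–Stokes solution with viscosity `ν` on
`ℝ³ × S`, `S` a **convex** time set, whose velocity decays rapidly in space uniformly in
`t ∈ S` (`HasUniformRapidDecayOn S u`), the helicity `t ↦ ∫ ⟪u(t), curl u(t)⟫` has derivative
`−2ν · superhelicity (u t)` within `S` at every `t ∈ S`. (At an isolated point of `S` the
statement is vacuous; at an accumulation point `S` has unique differentiability and
`S ⊆ closure (interior S)`, and the proof is Frisch's: `d/dt ∫ ⟪u, ω⟫ = 2 ∫ ⟪∂ₜu, ω⟫` by
differentiation under the integral sign, `∂ₜ curl = curl ∂ₜ` and the self-adjointness of the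
curl, then `integral_inner_timeDerivWithin_curl_eq`.) No hypothesis on the pressure is needed
(`∇p` is bounded by the equation itself).
[cite: FrischTurbulence1995, §2.3 eqs. (2.24), (2.26)–(2.29)] [cite: MoffattTsinober1992, review] -/
theorem IsClassicalNSSolutionOn.hasDerivWithinAt_helicity
    (h : IsClassicalNSSolutionOn S ν 0 u p) (hS : Convex ℝ S)
    (hu : HasUniformRapidDecayOn S u) {t : ℝ} (ht : t ∈ S) :
    HasDerivWithinAt (fun s => helicity (u s)) (-(2 * ν * superhelicity (u t))) S t := by
  -- isolated points of `S`: the statement is empty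
  by_cases hacc : AccPt t (𝓟 S)
  swap
  · exact hasDerivWithinAt_iff_hasFDerivWithinAt.2 (HasFDerivWithinAt.of_not_accPt hacc)
  have hU : UniqueDiffOn ℝ S := uniqueDiffOn_of_convex_of_accPt hS ht hacc
  have hcl : S ⊆ closure (interior S) := subset_closure_interior_of_convex_of_accPt hS ht hacc
  have hsm := h.smooth_velocity
  -- decay exponent and constants (uniform in time)
  have hr3 : (Module.finrank ℝ (EuclideanSpace ℝ (Fin 3)) : ℝ) < ((5 : ℕ) : ℝ) := by
    rw [finrank_euclideanSpace_fin]; norm_num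
  have hK0 : (0 : ℝ) ≤ ((5 : ℕ) : ℝ) := by norm_num
  obtain ⟨A0, hA0, hA0b⟩ := hu.norm_le_rpow 5
  obtain ⟨A1, hA1, hA1b⟩ := hu.norm_fderiv_le_rpow hsm hU 5
  obtain ⟨A3, hA3, hA3b⟩ := hu.norm_timeDerivWithin_le_rpow hsm hU 5
  obtain ⟨A4, hA4, hA4b⟩ := hu.norm_fderiv_timeDerivWithin_le_rpow hsm hU 5
  set C : ℝ := A0 + A1 + A3 + A4 with hC_def
  have hC : 0 ≤ C := by rw [hC_def]; positivity
  have h0 : ∀ s ∈ S, ∀ x, ‖u s x‖ ≤ C * (1 + ‖x‖) ^ (-((5 : ℕ) : ℝ)) := fun s hs x =>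
    le_decay_of_le_decay x (hA0b s hs x) (by rw [hC_def]; linarith)
  have h1 : ∀ s ∈ S, ∀ x, ‖fderiv ℝ (u s) x‖ ≤ C * (1 + ‖x‖) ^ (-((5 : ℕ) : ℝ)) := fun s hs x =>
    le_decay_of_le_decay x (hA1b s hs x) (by rw [hC_def]; linarith)
  have h3 : ∀ s ∈ S, ∀ x,
      ‖FluidPDE.timeDerivWithin S u s x‖ ≤ C * (1 + ‖x‖) ^ (-((5 : ℕ) : ℝ)) :=
    fun s hs x => le_decay_of_le_decay x (hA3b s hs x) (by rw [hC_def]; linarith)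
  have h4 : ∀ s ∈ S, ∀ x,
      ‖fderiv ℝ (FluidPDE.timeDerivWithin S u s) x‖ ≤ C * (1 + ‖x‖) ^ (-((5 : ℕ) : ℝ)) :=
    fun s hs x => le_decay_of_le_decay x (hA4b s hs x) (by rw [hC_def]; linarith)
  have hw1 (x : EuclideanSpace ℝ (Fin 3)) : (1 + ‖x‖) ^ (-((5 : ℕ) : ℝ)) ≤ (1 : ℝ) :=
    rpow_neg_le_one x hK0
  -- curls: `‖curl (u s) x‖`, `‖curl (∂ₜu s) x‖`
  have hω0 : ∀ s ∈ S, ∀ x, ‖curl (u s) x‖ ≤ ‖curlCLM‖ * C * (1 + ‖x‖) ^ (-((5 : ℕ) : ℝ)) :=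
    fun s hs x => by
    calc ‖curl (u s) x‖ ≤ ‖curlCLM‖ * ‖fderiv ℝ (u s) x‖ := norm_curl_le _ x
      _ ≤ ‖curlCLM‖ * (C * (1 + ‖x‖) ^ (-((5 : ℕ) : ℝ))) := by gcongr; exact h1 s hs x
      _ = ‖curlCLM‖ * C * (1 + ‖x‖) ^ (-((5 : ℕ) : ℝ)) := by ring
  have hωt : ∀ s ∈ S, ∀ x, ‖curl (FluidPDE.timeDerivWithin S u s) x‖ ≤
      ‖curlCLM‖ * C * (1 + ‖x‖) ^ (-((5 : ℕ) : ℝ)) := fun s hs x => by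
    calc ‖curl (FluidPDE.timeDerivWithin S u s) x‖
        ≤ ‖curlCLM‖ * ‖fderiv ℝ (FluidPDE.timeDerivWithin S u s) x‖ := norm_curl_le _ x
      _ ≤ ‖curlCLM‖ * (C * (1 + ‖x‖) ^ (-((5 : ℕ) : ℝ))) := by gcongr; exact h4 s hs x
      _ = ‖curlCLM‖ * C * (1 + ‖x‖) ^ (-((5 : ℕ) : ℝ)) := by ring
  -- regularity of the slices
  have hv1 : ∀ s ∈ S, ContDiff ℝ 1 (u s) := fun s hs =>
    contDiff_infty.1 (h.contDiff_velocity hs) 1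
  have huc : ∀ s ∈ S, Continuous (u s) := fun s hs => hsm.continuous_slice hs
  have hsmt : IsSmoothSpaceTimeOn S (FluidPDE.timeDerivWithin S u) := hsm.timeDerivWithin hU
  have ha1 : ∀ s ∈ S, ContDiff ℝ 1 (FluidPDE.timeDerivWithin S u s) := fun s hs =>
    contDiff_infty.1 (hsmt.contDiff_slice hs) 1
  have hac : ∀ s ∈ S, Continuous (FluidPDE.timeDerivWithin S u s) := fun s hs =>
    hsmt.continuous_slice hs
  -- the vorticity as a jointly smooth field and its time derivative
  have hωst : IsSmoothSpaceTimeOn S (vorticity u) := (hsm.fderiv_slice hU).clm_comp curlCLM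
  have hdω : ∀ s ∈ S, ∀ x, HasDerivWithinAt (fun s' => curl (u s') x)
      (curl (FluidPDE.timeDerivWithin S u s) x) S s := fun s hs x => by
    rw [hsm.curl_timeDerivWithin hU hcl hs x]
    exact hωst.hasDerivWithinAt_timeDerivWithin hU hs x
  -- the dominating function
  set bound : EuclideanSpace ℝ (Fin 3) → ℝ := fun x =>
    2 * (‖curlCLM‖ * C * C) * (1 + ‖x‖) ^ (-((5 : ℕ) : ℝ)) with hbound_def
  have hbound : Integrable bound := by
    have := (integrable_one_add_norm (E := EuclideanSpace ℝ (Fin 3)) (μ := volume)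
      hr3).const_mul (2 * (‖curlCLM‖ * C * C))
    simpa [hbound_def] using this
  have hpair : ∀ x a b : EuclideanSpace ℝ (Fin 3), ‖a‖ ≤ C * (1 + ‖x‖) ^ (-((5 : ℕ) : ℝ)) →
      ‖b‖ ≤ ‖curlCLM‖ * C * (1 + ‖x‖) ^ (-((5 : ℕ) : ℝ)) →
      ‖⟪a, b⟫‖ ≤ ‖curlCLM‖ * C * C * (1 + ‖x‖) ^ (-((5 : ℕ) : ℝ)) := by
    intro x a b ha hb
    calc ‖⟪a, b⟫‖ ≤ ‖a‖ * ‖b‖ := norm_inner_le_norm _ _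
      _ ≤ C * (1 + ‖x‖) ^ (-((5 : ℕ) : ℝ)) * (‖curlCLM‖ * C * (1 + ‖x‖) ^ (-((5 : ℕ) : ℝ))) :=
          mul_le_mul ha hb (norm_nonneg _) (by positivity)
      _ ≤ C * 1 * (‖curlCLM‖ * C * (1 + ‖x‖) ^ (-((5 : ℕ) : ℝ))) := by gcongr; exact hw1 x
      _ = ‖curlCLM‖ * C * C * (1 + ‖x‖) ^ (-((5 : ℕ) : ℝ)) := by ring
  have hF'le : ∀ s ∈ S, ∀ x, ‖⟪u s x, curl (FluidPDE.timeDerivWithin S u s) x⟫ +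
      ⟪FluidPDE.timeDerivWithin S u s x, curl (u s) x⟫‖ ≤ bound x := by
    intro s hs x
    refine (norm_add_le _ _).trans ?_
    have e : bound x = ‖curlCLM‖ * C * C * (1 + ‖x‖) ^ (-((5 : ℕ) : ℝ)) +
        ‖curlCLM‖ * C * C * (1 + ‖x‖) ^ (-((5 : ℕ) : ℝ)) := by
      simp only [hbound_def]; ring
    rw [e]
    exact add_le_add (hpair x _ _ (h0 s hs x) (hωt s hs x))
      (hpair x _ _ (h3 s hs x) (hω0 s hs x))
  have hFle : ∀ s ∈ S, ∀ x, ‖⟪u s x, curl (u s) x⟫‖ ≤ bound x := by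
    intro s hs x
    refine (hpair x _ _ (h0 s hs x) (hω0 s hs x)).trans ?_
    simp only [hbound_def]
    have : 0 ≤ ‖curlCLM‖ * C * C * (1 + ‖x‖) ^ (-((5 : ℕ) : ℝ)) := by positivity
    linarith
  have hIe : Integrable fun x => ⟪u t x, curl (u t) x⟫ :=
    Integrable.mono' hbound ((huc t ht).inner (continuous_curl (hv1 t ht))).aestronglyMeasurable
      (Eventually.of_forall (hFle t ht))
  -- (1) differentiate under the integral sign within `S`
  have hD : HasDerivWithinAt (fun s => ∫ x, ⟪u s x, curl (u s) x⟫)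
      (∫ x, (⟪u t x, curl (FluidPDE.timeDerivWithin S u t) x⟫ +
        ⟪FluidPDE.timeDerivWithin S u t x, curl (u t) x⟫)) S t := by
    refine hasDerivWithinAt_integral_of_dominated_convex hS ht
      (F := fun s x => ⟪u s x, curl (u s) x⟫)
      (F' := fun s x => ⟪u s x, curl (FluidPDE.timeDerivWithin S u s) x⟫ +
        ⟪FluidPDE.timeDerivWithin S u s x, curl (u s) x⟫) (bound := bound) ?_ hIe hF'le hbound ?_
    · exact fun s hs => ((huc s hs).inner (continuous_curl (hv1 s hs))).aestronglyMeasurable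
    · intro s hs x
      exact (hsm.hasDerivWithinAt_timeDerivWithin hU hs x).inner ℝ (hdω s hs x)
  -- (2) the derivative is `2 ∫ ⟪∂ₜu, ω⟫ = -2ν S(u t)`
  have hI1 : Integrable fun x => ⟪u t x, curl (FluidPDE.timeDerivWithin S u t) x⟫ := by
    refine integrable_of_norm_le_rpow_neg ((huc t ht).inner (continuous_curl (ha1 t ht)))
      (C := ‖curlCLM‖ * C * C) hr3 fun x => ?_
    exact hpair x _ _ (h0 t ht x) (hωt t ht x)
  have hI2 : Integrable fun x => ⟪FluidPDE.timeDerivWithin S u t x, curl (u t) x⟫ := by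
    refine integrable_of_norm_le_rpow_neg ((hac t ht).inner (continuous_curl (hv1 t ht)))
      (C := ‖curlCLM‖ * C * C) hr3 fun x => ?_
    exact hpair x _ _ (h3 t ht x) (hω0 t ht x)
  have hswap : ∫ x, ⟪u t x, curl (FluidPDE.timeDerivWithin S u t) x⟫ =
      ∫ x, ⟪FluidPDE.timeDerivWithin S u t x, curl (u t) x⟫ := by
    have := integral_inner_curl_eq_integral_inner_curl_of_decay (hv1 t ht) (ha1 t ht) hC
      (r := ((5 : ℕ) : ℝ)) (by norm_num) (h0 t ht) (h1 t ht) (h3 t ht) (h4 t ht)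
    -- `∫ ⟪curl u, ∂ₜu⟫ = ∫ ⟪u, curl ∂ₜu⟫`
    rw [← this]
    exact integral_congr_ae (Eventually.of_forall fun x => real_inner_comm _ _)
  have hval : ∫ x, (⟪u t x, curl (FluidPDE.timeDerivWithin S u t) x⟫ +
      ⟪FluidPDE.timeDerivWithin S u t x, curl (u t) x⟫) = -(2 * ν * superhelicity (u t)) := by
    rw [integral_add hI1 hI2, hswap, h.integral_inner_timeDerivWithin_curl_eq hU hu ht, ← two_mul,
      mul_neg, ← mul_assoc]
  rw [hval] at hD
  exact hD

/-- The Euler case `ν = 0` of the balance law: the helicity of a decaying classical Euler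
solution has zero derivative within a convex time set (the differential form of
Majda–Bertozzi, Prop. 1.12 (iv), eq. (1.67); the integrated form is the tree's
`euler_helicity_conservation_holds`).
[cite: MajdaBertozziCUP2002, §1.7 Prop. 1.12 (iv), eq. (1.67), p. 24] -/
theorem IsClassicalEulerSolutionOn.hasDerivWithinAt_helicity
    (h : IsClassicalEulerSolutionOn S 0 u p) (hS : Convex ℝ S)
    (hu : HasUniformRapidDecayOn S u) {t : ℝ} (ht : t ∈ S) :
    HasDerivWithinAt (fun s => helicity (u s)) 0 S t := by
  have := IsClassicalNSSolutionOn.hasDerivWithinAt_helicity h hS hu ht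
  simpa using this

end Balance

end Literature.Analysis.FluidPDE
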